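import Summits.ValiantsHypothesis.ValiantsHypothesis.Theorems.LacunarySymmetroidMatrixDescartesPivotRankOneNullDirection

/-!
# `MatrixDescartes` census — rank-one `(2,4)₁`: the NEEDLE IDENTITY
# (the Descartes derivatives `x·f′ − μ·f` of `f = det F` are combinations of the needle forms `F(x)[vₖ^⊥]`;
#  the sign of `f′` at a positive root is decided by the letters' needle forms)

HONEST FRAMING.  Object-search cell `pub-symmetroid`, seat `val-sym-mdr-p1` (generation 17); helper file `--supports` the crux item
stmt-ValiantsHypothesis-18050 (`Theses.LacunarySymmetroid.MatrixDescartes`, OPEN, on HOLD) with NO closure claim.  An exact INSTRUMENT for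
the rank-one `(2,4)₁` cell (`F = X^e J + ∑ₖ wₖ X^{dₖ} vₖvₖᵀ`, `J` real symmetric `2 × 2`, ANY exponents), companion of the window lemma of
`…PivotRankOneNullDirection` (generation 16): it converts Rolle / sign-of-derivative information at the roots of `f = det F` into
inequalities between the NEEDLE FORMS `qₖ(x) := vₖ^⊥ᵀ F(x) vₖ^⊥` of the four letters (the forms in which letter `k` is invisible).  Nothing
here bears on `MatrixDescartes` in its window, on `DoorA26` / `DoorA34`, registers / credences, or `VP ≠ VNP`; the rank-one register is
unchanged.

WHAT IS PROVED.
* `x_mul_eval_derivative_C_mul_X_pow` — `x · (C a · X^n)′(x) = n · a · x^n` (all `n`, all real `x`).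
* **`needleIdentity` (general weight `μ`)** — for every real `μ` and `x`:
  `x·f′(x) − μ·f(x) = (e − μ/2)·x^e·(2x^e·det J + ∑ₖ wₖ x^{dₖ} J[vₖ^⊥]) + ∑ₖ (dₖ − μ/2)·wₖ x^{dₖ}·F(x)[vₖ^⊥]`,
  where `J[z] = zᵀJz`, `F(x)[z] = zᵀF(x)z` and `vₖ^⊥ = (vₖ₁, −vₖ₀)`.  Mechanism: for `2 × 2` matrices `adj` is linear and
  `tr(adj(A)·vvᵀ) = A[v^⊥]`, `d/dx det F = tr(adj F · F′)`, `tr(adj F · F) = 2 det F`; here certified by `ring` on the eleven-nomial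
  expansion `det_rankOne_four`.
* **`needleIdentity_pivot` (`μ = 2e`, the pivot killed)** — `x·f′(x) − 2e·f(x) = ∑ₖ (dₖ − e)·wₖ x^{dₖ}·F(x)[vₖ^⊥]`.
* `form_nonneg_of_det_zero` — a binary form with `ac = b²` taking one positive value is everywhere `≥ 0`; hence
  **`needleForm_nonneg_at_root`**: at a positive root `r` of `f` (with `det J < 0`, `wₖ ≥ 0`) every needle form is `≥ 0`
  (`F(r)` is positive semidefinite: singular, with the positive direction supplied by `J`).
* **`deriv_at_root`** — at a positive root `r`: `r·f′(r) = ∑ₖ (dₖ − e)·wₖ r^{dₖ}·F(r)[vₖ^⊥]` with all four forms `≥ 0`.  So the SIGN of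
  `f′` at a root is a weighted vote of the letters: letters above the pivot vote `+`, letters below vote `−`, letter `k` with weight
  `|dₖ − e|·wₖ r^{dₖ}·F(r)[vₖ^⊥] = |dₖ − e|·wₖ r^{dₖ}·μ(r)·(n(r) ∧ vₖ)²` (`F(r) = μ(r)·n(r)n(r)ᵀ`): **`deriv_nonneg_at_root_of_above`** — if
  every letter lies above the pivot (`e ≤ dₖ`), `f′(r) ≥ 0` at every positive root (no down-crossing: the one-window structure of the
  `0|4` split, cf. `…PivotRankOneOuterSplits`); **`below_outweighs_of_deriv_neg`** / **`below_needle_pos_of_deriv_neg`** — at a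
  down-crossing root (`f′(r) < 0`): `(e − d₀)·w₀ r^{d₀}·F(r)[v₀^⊥] > ∑_{k≥1} (dₖ − e)·wₖ r^{dₖ}·F(r)[vₖ^⊥]`, and on the `1|3` split
  (`e ≤ d₁, d₂, d₃`) the right side is `≥ 0`, so `F(r)[v₀^⊥] > 0`.
READING (seat memo T-PROFILE.md, evidence on the item): with the window lemma these are the exact ingredients of the structural route to
«rank-one (2,4)₁ = 8» (window count `N ≤ 4` on the 1/3 split); the count itself is OPEN.

[folklore] `2 × 2` adjugates and quadratic forms; Mathlib `Polynomial.derivative`.  No definitions, no named facts.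
-/

-- `Summit.ValiantsHypothesis.ValiantsHypothesis.…` repeats a component by the D-0017 layout
-- (single-conjunct summit), which the `dupNamespace` linter flags; the name is mandated.
set_option linter.dupNamespace false

namespace Summit.ValiantsHypothesis.ValiantsHypothesis.Theorems.LacunarySymmetroidMatrixDescartes.Pivot.NullDirection

open Polynomial Matrix Finset Set
open scoped BigOperators
open Summit.ValiantsHypothesis.ValiantsHypothesis.Theorems.LacunarySymmetroidMatrixDescartes.Pivot.TwoDirections.BlockLaw
  (det_rankOne_four)

/-! ## 1. Calculus of monomials -/

/-- `x · (C a · X^n)′(x) = n · a · x^n` for every `n` (for `n = 0` both sides vanish). [folklore] -/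
theorem x_mul_eval_derivative_C_mul_X_pow (a x : ℝ) (n : ℕ) :
    x * (Polynomial.derivative (Polynomial.C a * X ^ n)).eval x = (n : ℝ) * a * x ^ n := by
  rw [Polynomial.derivative_C_mul_X_pow, Polynomial.eval_mul, Polynomial.eval_C, Polynomial.eval_pow, Polynomial.eval_X]
  rcases Nat.eq_zero_or_pos n with h | h
  · subst h; simp
  · obtain ⟨m, rfl⟩ : ∃ m, n = m + 1 := ⟨n - 1, by omega⟩
    rw [Nat.add_sub_cancel, pow_succ]
    push_cast
    ring

/-! ## 2. The needle identity -/

/-- **NEEDLE IDENTITY (general weight).**  For `F = X^e J + ∑ₖ wₖ X^{dₖ} vₖvₖᵀ` (`J` symmetric) and `f = det F`, every real `μ` and `x`: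
`x·f′(x) − μ·f(x) = (e − μ/2)·x^e·(2x^e det J + ∑ₖ wₖx^{dₖ} J[vₖ^⊥]) + ∑ₖ (dₖ − μ/2)·wₖx^{dₖ}·F(x)[vₖ^⊥]`, `vₖ^⊥ = (vₖ₁, −vₖ₀)`.
[this file] -/
theorem needleIdentity (e d₀ d₁ d₂ d₃ : ℕ) (J : Matrix (Fin 2) (Fin 2) ℝ) (hJ : J 1 0 = J 0 1) (v₀ v₁ v₂ v₃ : Fin 2 → ℝ)
    (w₀ w₁ w₂ w₃ μ x : ℝ) :
    x * (Polynomial.derivative (Matrix.det (((X : ℝ[X]) ^ e) • J.map Polynomial.C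
        + (Polynomial.C w₀ * X ^ d₀) • (vecMulVec v₀ v₀).map Polynomial.C
        + (Polynomial.C w₁ * X ^ d₁) • (vecMulVec v₁ v₁).map Polynomial.C
        + (Polynomial.C w₂ * X ^ d₂) • (vecMulVec v₂ v₂).map Polynomial.C
        + (Polynomial.C w₃ * X ^ d₃) • (vecMulVec v₃ v₃).map Polynomial.C))).eval x
      - μ * (Matrix.det (((X : ℝ[X]) ^ e) • J.map Polynomial.C
        + (Polynomial.C w₀ * X ^ d₀) • (vecMulVec v₀ v₀).map Polynomial.C
        + (Polynomial.C w₁ * X ^ d₁) • (vecMulVec v₁ v₁).map Polynomial.C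
        + (Polynomial.C w₂ * X ^ d₂) • (vecMulVec v₂ v₂).map Polynomial.C
        + (Polynomial.C w₃ * X ^ d₃) • (vecMulVec v₃ v₃).map Polynomial.C)).eval x
      = ((e : ℝ) - μ / 2) * x ^ e
          * (2 * x ^ e * (J 0 0 * J 1 1 - J 0 1 ^ 2)
            + w₀ * x ^ d₀ * (J 0 0 * v₀ 1 ^ 2 - 2 * J 0 1 * (v₀ 1 * v₀ 0) + J 1 1 * v₀ 0 ^ 2)
            + w₁ * x ^ d₁ * (J 0 0 * v₁ 1 ^ 2 - 2 * J 0 1 * (v₁ 1 * v₁ 0) + J 1 1 * v₁ 0 ^ 2)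
            + w₂ * x ^ d₂ * (J 0 0 * v₂ 1 ^ 2 - 2 * J 0 1 * (v₂ 1 * v₂ 0) + J 1 1 * v₂ 0 ^ 2)
            + w₃ * x ^ d₃ * (J 0 0 * v₃ 1 ^ 2 - 2 * J 0 1 * (v₃ 1 * v₃ 0) + J 1 1 * v₃ 0 ^ 2))
        + ((d₀ : ℝ) - μ / 2) * (w₀ * x ^ d₀)
          * (x ^ e * (J 0 0 * (v₀ 1) ^ 2 + 2 * J 0 1 * (v₀ 1 * (-v₀ 0)) + J 1 1 * (-v₀ 0) ^ 2)
            + w₀ * x ^ d₀ * (v₀ 0 * v₀ 1 + v₀ 1 * (-v₀ 0)) ^ 2 + w₁ * x ^ d₁ * (v₁ 0 * v₀ 1 + v₁ 1 * (-v₀ 0)) ^ 2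
            + w₂ * x ^ d₂ * (v₂ 0 * v₀ 1 + v₂ 1 * (-v₀ 0)) ^ 2 + w₃ * x ^ d₃ * (v₃ 0 * v₀ 1 + v₃ 1 * (-v₀ 0)) ^ 2)
        + ((d₁ : ℝ) - μ / 2) * (w₁ * x ^ d₁)
          * (x ^ e * (J 0 0 * (v₁ 1) ^ 2 + 2 * J 0 1 * (v₁ 1 * (-v₁ 0)) + J 1 1 * (-v₁ 0) ^ 2)
            + w₀ * x ^ d₀ * (v₀ 0 * v₁ 1 + v₀ 1 * (-v₁ 0)) ^ 2 + w₁ * x ^ d₁ * (v₁ 0 * v₁ 1 + v₁ 1 * (-v₁ 0)) ^ 2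
            + w₂ * x ^ d₂ * (v₂ 0 * v₁ 1 + v₂ 1 * (-v₁ 0)) ^ 2 + w₃ * x ^ d₃ * (v₃ 0 * v₁ 1 + v₃ 1 * (-v₁ 0)) ^ 2)
        + ((d₂ : ℝ) - μ / 2) * (w₂ * x ^ d₂)
          * (x ^ e * (J 0 0 * (v₂ 1) ^ 2 + 2 * J 0 1 * (v₂ 1 * (-v₂ 0)) + J 1 1 * (-v₂ 0) ^ 2)
            + w₀ * x ^ d₀ * (v₀ 0 * v₂ 1 + v₀ 1 * (-v₂ 0)) ^ 2 + w₁ * x ^ d₁ * (v₁ 0 * v₂ 1 + v₁ 1 * (-v₂ 0)) ^ 2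
            + w₂ * x ^ d₂ * (v₂ 0 * v₂ 1 + v₂ 1 * (-v₂ 0)) ^ 2 + w₃ * x ^ d₃ * (v₃ 0 * v₂ 1 + v₃ 1 * (-v₂ 0)) ^ 2)
        + ((d₃ : ℝ) - μ / 2) * (w₃ * x ^ d₃)
          * (x ^ e * (J 0 0 * (v₃ 1) ^ 2 + 2 * J 0 1 * (v₃ 1 * (-v₃ 0)) + J 1 1 * (-v₃ 0) ^ 2)
            + w₀ * x ^ d₀ * (v₀ 0 * v₃ 1 + v₀ 1 * (-v₃ 0)) ^ 2 + w₁ * x ^ d₁ * (v₁ 0 * v₃ 1 + v₁ 1 * (-v₃ 0)) ^ 2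
            + w₂ * x ^ d₂ * (v₂ 0 * v₃ 1 + v₂ 1 * (-v₃ 0)) ^ 2 + w₃ * x ^ d₃ * (v₃ 0 * v₃ 1 + v₃ 1 * (-v₃ 0)) ^ 2) := by
  rw [det_rankOne_four]
  simp only [Polynomial.derivative_add, Polynomial.eval_add, mul_add, x_mul_eval_derivative_C_mul_X_pow]
  simp only [Polynomial.eval_mul, Polynomial.eval_C, Polynomial.eval_pow, Polynomial.eval_X, Matrix.det_fin_two, hJ]
  push_cast
  ring

/-- **NEEDLE IDENTITY, PIVOT KILLED (`μ = 2e`).**  `x·f′(x) − 2e·f(x) = ∑ₖ (dₖ − e)·wₖ x^{dₖ}·F(x)[vₖ^⊥]`: the Descartes derivative of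
`det F` that removes the pivot degree is the exponent-weighted sum of the four needle forms. [this file] -/
theorem needleIdentity_pivot (e d₀ d₁ d₂ d₃ : ℕ) (J : Matrix (Fin 2) (Fin 2) ℝ) (hJ : J 1 0 = J 0 1) (v₀ v₁ v₂ v₃ : Fin 2 → ℝ)
    (w₀ w₁ w₂ w₃ x : ℝ) :
    x * (Polynomial.derivative (Matrix.det (((X : ℝ[X]) ^ e) • J.map Polynomial.C
        + (Polynomial.C w₀ * X ^ d₀) • (vecMulVec v₀ v₀).map Polynomial.C
        + (Polynomial.C w₁ * X ^ d₁) • (vecMulVec v₁ v₁).map Polynomial.C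
        + (Polynomial.C w₂ * X ^ d₂) • (vecMulVec v₂ v₂).map Polynomial.C
        + (Polynomial.C w₃ * X ^ d₃) • (vecMulVec v₃ v₃).map Polynomial.C))).eval x
      - 2 * (e : ℝ) * (Matrix.det (((X : ℝ[X]) ^ e) • J.map Polynomial.C
        + (Polynomial.C w₀ * X ^ d₀) • (vecMulVec v₀ v₀).map Polynomial.C
        + (Polynomial.C w₁ * X ^ d₁) • (vecMulVec v₁ v₁).map Polynomial.C
        + (Polynomial.C w₂ * X ^ d₂) • (vecMulVec v₂ v₂).map Polynomial.C
        + (Polynomial.C w₃ * X ^ d₃) • (vecMulVec v₃ v₃).map Polynomial.C)).eval x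
      = ((d₀ : ℝ) - e) * (w₀ * x ^ d₀)
          * (x ^ e * (J 0 0 * (v₀ 1) ^ 2 + 2 * J 0 1 * (v₀ 1 * (-v₀ 0)) + J 1 1 * (-v₀ 0) ^ 2)
            + w₀ * x ^ d₀ * (v₀ 0 * v₀ 1 + v₀ 1 * (-v₀ 0)) ^ 2 + w₁ * x ^ d₁ * (v₁ 0 * v₀ 1 + v₁ 1 * (-v₀ 0)) ^ 2
            + w₂ * x ^ d₂ * (v₂ 0 * v₀ 1 + v₂ 1 * (-v₀ 0)) ^ 2 + w₃ * x ^ d₃ * (v₃ 0 * v₀ 1 + v₃ 1 * (-v₀ 0)) ^ 2)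
        + ((d₁ : ℝ) - e) * (w₁ * x ^ d₁)
          * (x ^ e * (J 0 0 * (v₁ 1) ^ 2 + 2 * J 0 1 * (v₁ 1 * (-v₁ 0)) + J 1 1 * (-v₁ 0) ^ 2)
            + w₀ * x ^ d₀ * (v₀ 0 * v₁ 1 + v₀ 1 * (-v₁ 0)) ^ 2 + w₁ * x ^ d₁ * (v₁ 0 * v₁ 1 + v₁ 1 * (-v₁ 0)) ^ 2
            + w₂ * x ^ d₂ * (v₂ 0 * v₁ 1 + v₂ 1 * (-v₁ 0)) ^ 2 + w₃ * x ^ d₃ * (v₃ 0 * v₁ 1 + v₃ 1 * (-v₁ 0)) ^ 2)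
        + ((d₂ : ℝ) - e) * (w₂ * x ^ d₂)
          * (x ^ e * (J 0 0 * (v₂ 1) ^ 2 + 2 * J 0 1 * (v₂ 1 * (-v₂ 0)) + J 1 1 * (-v₂ 0) ^ 2)
            + w₀ * x ^ d₀ * (v₀ 0 * v₂ 1 + v₀ 1 * (-v₂ 0)) ^ 2 + w₁ * x ^ d₁ * (v₁ 0 * v₂ 1 + v₁ 1 * (-v₂ 0)) ^ 2
            + w₂ * x ^ d₂ * (v₂ 0 * v₂ 1 + v₂ 1 * (-v₂ 0)) ^ 2 + w₃ * x ^ d₃ * (v₃ 0 * v₂ 1 + v₃ 1 * (-v₂ 0)) ^ 2)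
        + ((d₃ : ℝ) - e) * (w₃ * x ^ d₃)
          * (x ^ e * (J 0 0 * (v₃ 1) ^ 2 + 2 * J 0 1 * (v₃ 1 * (-v₃ 0)) + J 1 1 * (-v₃ 0) ^ 2)
            + w₀ * x ^ d₀ * (v₀ 0 * v₃ 1 + v₀ 1 * (-v₃ 0)) ^ 2 + w₁ * x ^ d₁ * (v₁ 0 * v₃ 1 + v₁ 1 * (-v₃ 0)) ^ 2
            + w₂ * x ^ d₂ * (v₂ 0 * v₃ 1 + v₂ 1 * (-v₃ 0)) ^ 2 + w₃ * x ^ d₃ * (v₃ 0 * v₃ 1 + v₃ 1 * (-v₃ 0)) ^ 2) := by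
  have h := needleIdentity e d₀ d₁ d₂ d₃ J hJ v₀ v₁ v₂ v₃ w₀ w₁ w₂ w₃ (2 * e) x
  rw [h]
  ring

/-! ## 3. The needle forms are non-negative at a root -/

/-- A real binary form `a z₀² + 2b z₀z₁ + c z₁²` with `ac − b² = 0` which takes a positive value somewhere is non-negative everywhere
(it is a non-negative multiple of a square). [folklore] -/
theorem form_nonneg_of_det_zero (a b c y₀ y₁ : ℝ) (hdet : a * c - b ^ 2 = 0) (hy : 0 < a * y₀ ^ 2 + 2 * b * (y₀ * y₁) + c * y₁ ^ 2)
    (z₀ z₁ : ℝ) : 0 ≤ a * z₀ ^ 2 + 2 * b * (z₀ * z₁) + c * z₁ ^ 2 := by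
  rcases lt_trichotomy a 0 with ha | ha | ha
  · -- `a < 0`: `a · form = (a z₀ + b z₁)²` would make the form `≤ 0` everywhere, contradicting `hy`
    have hid : a * (a * y₀ ^ 2 + 2 * b * (y₀ * y₁) + c * y₁ ^ 2) = (a * y₀ + b * y₁) ^ 2 + (a * c - b ^ 2) * y₁ ^ 2 := by ring
    rw [hdet, zero_mul, add_zero] at hid
    nlinarith [sq_nonneg (a * y₀ + b * y₁), mul_neg_of_neg_of_pos ha hy]
  · subst ha
    have hb : b = 0 := by nlinarith [sq_nonneg b]
    subst hb
    have hc : 0 < c := by nlinarith [sq_nonneg y₁]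
    nlinarith [sq_nonneg z₁]
  · have hid : a * (a * z₀ ^ 2 + 2 * b * (z₀ * z₁) + c * z₁ ^ 2) = (a * z₀ + b * z₁) ^ 2 + (a * c - b ^ 2) * z₁ ^ 2 := by ring
    rw [hdet, zero_mul, add_zero] at hid
    nlinarith [sq_nonneg (a * z₀ + b * z₁)]

/-- **Needle forms at a root.**  If `det J < 0`, the weights are `≥ 0`, `x > 0` and `(det F)(x) = 0`, then `F(x)[z] ≥ 0` for EVERY real `z`
(`F(x)` is singular and — through the positive direction of `J` — not negative semidefinite, hence positive semidefinite). [this file] -/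
theorem form_nonneg_at_root (e d₀ d₁ d₂ d₃ : ℕ) (J : Matrix (Fin 2) (Fin 2) ℝ) (hJ : J 1 0 = J 0 1)
    (hdJ : J 0 0 * J 1 1 - J 0 1 ^ 2 < 0) (v₀ v₁ v₂ v₃ : Fin 2 → ℝ) (w₀ w₁ w₂ w₃ : ℝ) (hw₀ : 0 ≤ w₀) (hw₁ : 0 ≤ w₁) (hw₂ : 0 ≤ w₂)
    (hw₃ : 0 ≤ w₃) (x : ℝ) (hx : 0 < x)
    (hroot : (Matrix.det (((X : ℝ[X]) ^ e) • J.map Polynomial.C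
        + (Polynomial.C w₀ * X ^ d₀) • (vecMulVec v₀ v₀).map Polynomial.C
        + (Polynomial.C w₁ * X ^ d₁) • (vecMulVec v₁ v₁).map Polynomial.C
        + (Polynomial.C w₂ * X ^ d₂) • (vecMulVec v₂ v₂).map Polynomial.C
        + (Polynomial.C w₃ * X ^ d₃) • (vecMulVec v₃ v₃).map Polynomial.C)).eval x = 0) (z₀ z₁ : ℝ) :
    0 ≤ x ^ e * (J 0 0 * z₀ ^ 2 + 2 * J 0 1 * (z₀ * z₁) + J 1 1 * z₁ ^ 2) + w₀ * x ^ d₀ * (v₀ 0 * z₀ + v₀ 1 * z₁) ^ 2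
        + w₁ * x ^ d₁ * (v₁ 0 * z₀ + v₁ 1 * z₁) ^ 2 + w₂ * x ^ d₂ * (v₂ 0 * z₀ + v₂ 1 * z₁) ^ 2
        + w₃ * x ^ d₃ * (v₃ 0 * z₀ + v₃ 1 * z₁) ^ 2 := by
  by_contra hneg
  push Not at hneg
  have hlt := eval_det_neg_of_neg_direction e d₀ d₁ d₂ d₃ J hJ hdJ v₀ v₁ v₂ v₃ w₀ w₁ w₂ w₃ hw₀ hw₁ hw₂ hw₃ x hx z₀ z₁ hneg
  rw [hroot] at hlt
  exact lt_irrefl _ hlt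

/-! ## 4. The sign of `f′` at a root -/

/-- **`f′` at a root.**  At a positive root `r` of `f = det F` (`J` symmetric): `r·f′(r) = ∑ₖ (dₖ − e)·wₖ r^{dₖ}·F(r)[vₖ^⊥]`. [this file] -/
theorem deriv_at_root (e d₀ d₁ d₂ d₃ : ℕ) (J : Matrix (Fin 2) (Fin 2) ℝ) (hJ : J 1 0 = J 0 1) (v₀ v₁ v₂ v₃ : Fin 2 → ℝ)
    (w₀ w₁ w₂ w₃ r : ℝ)
    (hroot : (Matrix.det (((X : ℝ[X]) ^ e) • J.map Polynomial.C
        + (Polynomial.C w₀ * X ^ d₀) • (vecMulVec v₀ v₀).map Polynomial.C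
        + (Polynomial.C w₁ * X ^ d₁) • (vecMulVec v₁ v₁).map Polynomial.C
        + (Polynomial.C w₂ * X ^ d₂) • (vecMulVec v₂ v₂).map Polynomial.C
        + (Polynomial.C w₃ * X ^ d₃) • (vecMulVec v₃ v₃).map Polynomial.C)).eval r = 0) :
    r * (Polynomial.derivative (Matrix.det (((X : ℝ[X]) ^ e) • J.map Polynomial.C
        + (Polynomial.C w₀ * X ^ d₀) • (vecMulVec v₀ v₀).map Polynomial.C
        + (Polynomial.C w₁ * X ^ d₁) • (vecMulVec v₁ v₁).map Polynomial.C
        + (Polynomial.C w₂ * X ^ d₂) • (vecMulVec v₂ v₂).map Polynomial.C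
        + (Polynomial.C w₃ * X ^ d₃) • (vecMulVec v₃ v₃).map Polynomial.C))).eval r
      = ((d₀ : ℝ) - e) * (w₀ * r ^ d₀)
          * (r ^ e * (J 0 0 * (v₀ 1) ^ 2 + 2 * J 0 1 * (v₀ 1 * (-v₀ 0)) + J 1 1 * (-v₀ 0) ^ 2)
            + w₀ * r ^ d₀ * (v₀ 0 * v₀ 1 + v₀ 1 * (-v₀ 0)) ^ 2 + w₁ * r ^ d₁ * (v₁ 0 * v₀ 1 + v₁ 1 * (-v₀ 0)) ^ 2
            + w₂ * r ^ d₂ * (v₂ 0 * v₀ 1 + v₂ 1 * (-v₀ 0)) ^ 2 + w₃ * r ^ d₃ * (v₃ 0 * v₀ 1 + v₃ 1 * (-v₀ 0)) ^ 2)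
        + ((d₁ : ℝ) - e) * (w₁ * r ^ d₁)
          * (r ^ e * (J 0 0 * (v₁ 1) ^ 2 + 2 * J 0 1 * (v₁ 1 * (-v₁ 0)) + J 1 1 * (-v₁ 0) ^ 2)
            + w₀ * r ^ d₀ * (v₀ 0 * v₁ 1 + v₀ 1 * (-v₁ 0)) ^ 2 + w₁ * r ^ d₁ * (v₁ 0 * v₁ 1 + v₁ 1 * (-v₁ 0)) ^ 2
            + w₂ * r ^ d₂ * (v₂ 0 * v₁ 1 + v₂ 1 * (-v₁ 0)) ^ 2 + w₃ * r ^ d₃ * (v₃ 0 * v₁ 1 + v₃ 1 * (-v₁ 0)) ^ 2)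
        + ((d₂ : ℝ) - e) * (w₂ * r ^ d₂)
          * (r ^ e * (J 0 0 * (v₂ 1) ^ 2 + 2 * J 0 1 * (v₂ 1 * (-v₂ 0)) + J 1 1 * (-v₂ 0) ^ 2)
            + w₀ * r ^ d₀ * (v₀ 0 * v₂ 1 + v₀ 1 * (-v₂ 0)) ^ 2 + w₁ * r ^ d₁ * (v₁ 0 * v₂ 1 + v₁ 1 * (-v₂ 0)) ^ 2
            + w₂ * r ^ d₂ * (v₂ 0 * v₂ 1 + v₂ 1 * (-v₂ 0)) ^ 2 + w₃ * r ^ d₃ * (v₃ 0 * v₂ 1 + v₃ 1 * (-v₂ 0)) ^ 2)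
        + ((d₃ : ℝ) - e) * (w₃ * r ^ d₃)
          * (r ^ e * (J 0 0 * (v₃ 1) ^ 2 + 2 * J 0 1 * (v₃ 1 * (-v₃ 0)) + J 1 1 * (-v₃ 0) ^ 2)
            + w₀ * r ^ d₀ * (v₀ 0 * v₃ 1 + v₀ 1 * (-v₃ 0)) ^ 2 + w₁ * r ^ d₁ * (v₁ 0 * v₃ 1 + v₁ 1 * (-v₃ 0)) ^ 2
            + w₂ * r ^ d₂ * (v₂ 0 * v₃ 1 + v₂ 1 * (-v₃ 0)) ^ 2 + w₃ * r ^ d₃ * (v₃ 0 * v₃ 1 + v₃ 1 * (-v₃ 0)) ^ 2) := by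
  have h := needleIdentity_pivot e d₀ d₁ d₂ d₃ J hJ v₀ v₁ v₂ v₃ w₀ w₁ w₂ w₃ r
  rw [hroot, mul_zero, sub_zero] at h
  exact h

/-- **All letters above the pivot ⇒ no down-crossing.**  If `e ≤ dₖ` for every `k`, `det J < 0` and the weights are `≥ 0`, then at every
positive root `r` of `f = det F` one has `f′(r) ≥ 0` (every needle form is `≥ 0` at `r` and every vote is `+`).  This is the one-window
structure of the `0|4` split from the side of the derivative (cf. `…PivotRankOneOuterSplits`). [this file] -/
theorem deriv_nonneg_at_root_of_above (e d₀ d₁ d₂ d₃ : ℕ) (he₀ : e ≤ d₀) (he₁ : e ≤ d₁) (he₂ : e ≤ d₂) (he₃ : e ≤ d₃)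
    (J : Matrix (Fin 2) (Fin 2) ℝ) (hJ : J 1 0 = J 0 1) (hdJ : J 0 0 * J 1 1 - J 0 1 ^ 2 < 0) (v₀ v₁ v₂ v₃ : Fin 2 → ℝ)
    (w₀ w₁ w₂ w₃ : ℝ) (hw₀ : 0 ≤ w₀) (hw₁ : 0 ≤ w₁) (hw₂ : 0 ≤ w₂) (hw₃ : 0 ≤ w₃) (r : ℝ) (hr : 0 < r)
    (hroot : (Matrix.det (((X : ℝ[X]) ^ e) • J.map Polynomial.C
        + (Polynomial.C w₀ * X ^ d₀) • (vecMulVec v₀ v₀).map Polynomial.C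
        + (Polynomial.C w₁ * X ^ d₁) • (vecMulVec v₁ v₁).map Polynomial.C
        + (Polynomial.C w₂ * X ^ d₂) • (vecMulVec v₂ v₂).map Polynomial.C
        + (Polynomial.C w₃ * X ^ d₃) • (vecMulVec v₃ v₃).map Polynomial.C)).eval r = 0) :
    0 ≤ (Polynomial.derivative (Matrix.det (((X : ℝ[X]) ^ e) • J.map Polynomial.C
        + (Polynomial.C w₀ * X ^ d₀) • (vecMulVec v₀ v₀).map Polynomial.C
        + (Polynomial.C w₁ * X ^ d₁) • (vecMulVec v₁ v₁).map Polynomial.C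
        + (Polynomial.C w₂ * X ^ d₂) • (vecMulVec v₂ v₂).map Polynomial.C
        + (Polynomial.C w₃ * X ^ d₃) • (vecMulVec v₃ v₃).map Polynomial.C))).eval r := by
  have h := deriv_at_root e d₀ d₁ d₂ d₃ J hJ v₀ v₁ v₂ v₃ w₀ w₁ w₂ w₃ r hroot
  have q₀ := form_nonneg_at_root e d₀ d₁ d₂ d₃ J hJ hdJ v₀ v₁ v₂ v₃ w₀ w₁ w₂ w₃ hw₀ hw₁ hw₂ hw₃ r hr hroot (v₀ 1) (-v₀ 0)
  have q₁ := form_nonneg_at_root e d₀ d₁ d₂ d₃ J hJ hdJ v₀ v₁ v₂ v₃ w₀ w₁ w₂ w₃ hw₀ hw₁ hw₂ hw₃ r hr hroot (v₁ 1) (-v₁ 0)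
  have q₂ := form_nonneg_at_root e d₀ d₁ d₂ d₃ J hJ hdJ v₀ v₁ v₂ v₃ w₀ w₁ w₂ w₃ hw₀ hw₁ hw₂ hw₃ r hr hroot (v₂ 1) (-v₂ 0)
  have q₃ := form_nonneg_at_root e d₀ d₁ d₂ d₃ J hJ hdJ v₀ v₁ v₂ v₃ w₀ w₁ w₂ w₃ hw₀ hw₁ hw₂ hw₃ r hr hroot (v₃ 1) (-v₃ 0)
  have c₀ : 0 ≤ ((d₀ : ℝ) - e) * (w₀ * r ^ d₀) := mul_nonneg (sub_nonneg.2 (by exact_mod_cast he₀)) (by positivity)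
  have c₁ : 0 ≤ ((d₁ : ℝ) - e) * (w₁ * r ^ d₁) := mul_nonneg (sub_nonneg.2 (by exact_mod_cast he₁)) (by positivity)
  have c₂ : 0 ≤ ((d₂ : ℝ) - e) * (w₂ * r ^ d₂) := mul_nonneg (sub_nonneg.2 (by exact_mod_cast he₂)) (by positivity)
  have c₃ : 0 ≤ ((d₃ : ℝ) - e) * (w₃ * r ^ d₃) := mul_nonneg (sub_nonneg.2 (by exact_mod_cast he₃)) (by positivity)
  have hsum := add_nonneg (add_nonneg (add_nonneg (mul_nonneg c₀ q₀) (mul_nonneg c₁ q₁)) (mul_nonneg c₂ q₂)) (mul_nonneg c₃ q₃)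
  rw [← h] at hsum
  exact (mul_nonneg_iff_of_pos_left hr).mp hsum

/-- **A down-crossing is paid by the letters below the pivot** (bookkeeping form, any exponents, `J` symmetric): at a positive root `r` of
`f = det F` with `f′(r) < 0`, `(e − d₀)·w₀ r^{d₀}·F(r)[v₀^⊥] > ∑_{k≥1} (dₖ − e)·wₖ r^{dₖ}·F(r)[vₖ^⊥]` (a rearrangement of `deriv_at_root`). [this file] -/
theorem below_outweighs_of_deriv_neg (e d₀ d₁ d₂ d₃ : ℕ) (J : Matrix (Fin 2) (Fin 2) ℝ) (hJ : J 1 0 = J 0 1) (v₀ v₁ v₂ v₃ : Fin 2 → ℝ)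
    (w₀ w₁ w₂ w₃ : ℝ) (r : ℝ) (hr : 0 < r)
    (hroot : (Matrix.det (((X : ℝ[X]) ^ e) • J.map Polynomial.C
        + (Polynomial.C w₀ * X ^ d₀) • (vecMulVec v₀ v₀).map Polynomial.C
        + (Polynomial.C w₁ * X ^ d₁) • (vecMulVec v₁ v₁).map Polynomial.C
        + (Polynomial.C w₂ * X ^ d₂) • (vecMulVec v₂ v₂).map Polynomial.C
        + (Polynomial.C w₃ * X ^ d₃) • (vecMulVec v₃ v₃).map Polynomial.C)).eval r = 0)
    (hdown : (Polynomial.derivative (Matrix.det (((X : ℝ[X]) ^ e) • J.map Polynomial.C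
        + (Polynomial.C w₀ * X ^ d₀) • (vecMulVec v₀ v₀).map Polynomial.C
        + (Polynomial.C w₁ * X ^ d₁) • (vecMulVec v₁ v₁).map Polynomial.C
        + (Polynomial.C w₂ * X ^ d₂) • (vecMulVec v₂ v₂).map Polynomial.C
        + (Polynomial.C w₃ * X ^ d₃) • (vecMulVec v₃ v₃).map Polynomial.C))).eval r < 0) :
    ((d₁ : ℝ) - e) * (w₁ * r ^ d₁)
          * (r ^ e * (J 0 0 * (v₁ 1) ^ 2 + 2 * J 0 1 * (v₁ 1 * (-v₁ 0)) + J 1 1 * (-v₁ 0) ^ 2)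
            + w₀ * r ^ d₀ * (v₀ 0 * v₁ 1 + v₀ 1 * (-v₁ 0)) ^ 2 + w₁ * r ^ d₁ * (v₁ 0 * v₁ 1 + v₁ 1 * (-v₁ 0)) ^ 2
            + w₂ * r ^ d₂ * (v₂ 0 * v₁ 1 + v₂ 1 * (-v₁ 0)) ^ 2 + w₃ * r ^ d₃ * (v₃ 0 * v₁ 1 + v₃ 1 * (-v₁ 0)) ^ 2)
        + ((d₂ : ℝ) - e) * (w₂ * r ^ d₂)
          * (r ^ e * (J 0 0 * (v₂ 1) ^ 2 + 2 * J 0 1 * (v₂ 1 * (-v₂ 0)) + J 1 1 * (-v₂ 0) ^ 2)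
            + w₀ * r ^ d₀ * (v₀ 0 * v₂ 1 + v₀ 1 * (-v₂ 0)) ^ 2 + w₁ * r ^ d₁ * (v₁ 0 * v₂ 1 + v₁ 1 * (-v₂ 0)) ^ 2
            + w₂ * r ^ d₂ * (v₂ 0 * v₂ 1 + v₂ 1 * (-v₂ 0)) ^ 2 + w₃ * r ^ d₃ * (v₃ 0 * v₂ 1 + v₃ 1 * (-v₂ 0)) ^ 2)
        + ((d₃ : ℝ) - e) * (w₃ * r ^ d₃)
          * (r ^ e * (J 0 0 * (v₃ 1) ^ 2 + 2 * J 0 1 * (v₃ 1 * (-v₃ 0)) + J 1 1 * (-v₃ 0) ^ 2)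
            + w₀ * r ^ d₀ * (v₀ 0 * v₃ 1 + v₀ 1 * (-v₃ 0)) ^ 2 + w₁ * r ^ d₁ * (v₁ 0 * v₃ 1 + v₁ 1 * (-v₃ 0)) ^ 2
            + w₂ * r ^ d₂ * (v₂ 0 * v₃ 1 + v₂ 1 * (-v₃ 0)) ^ 2 + w₃ * r ^ d₃ * (v₃ 0 * v₃ 1 + v₃ 1 * (-v₃ 0)) ^ 2)
      < ((e : ℝ) - d₀) * (w₀ * r ^ d₀)
          * (r ^ e * (J 0 0 * (v₀ 1) ^ 2 + 2 * J 0 1 * (v₀ 1 * (-v₀ 0)) + J 1 1 * (-v₀ 0) ^ 2)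
            + w₀ * r ^ d₀ * (v₀ 0 * v₀ 1 + v₀ 1 * (-v₀ 0)) ^ 2 + w₁ * r ^ d₁ * (v₁ 0 * v₀ 1 + v₁ 1 * (-v₀ 0)) ^ 2
            + w₂ * r ^ d₂ * (v₂ 0 * v₀ 1 + v₂ 1 * (-v₀ 0)) ^ 2 + w₃ * r ^ d₃ * (v₃ 0 * v₀ 1 + v₃ 1 * (-v₀ 0)) ^ 2) := by
  have h := deriv_at_root e d₀ d₁ d₂ d₃ J hJ v₀ v₁ v₂ v₃ w₀ w₁ w₂ w₃ r hroot
  have hneg : r * (Polynomial.derivative (Matrix.det (((X : ℝ[X]) ^ e) • J.map Polynomial.C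
        + (Polynomial.C w₀ * X ^ d₀) • (vecMulVec v₀ v₀).map Polynomial.C
        + (Polynomial.C w₁ * X ^ d₁) • (vecMulVec v₁ v₁).map Polynomial.C
        + (Polynomial.C w₂ * X ^ d₂) • (vecMulVec v₂ v₂).map Polynomial.C
        + (Polynomial.C w₃ * X ^ d₃) • (vecMulVec v₃ v₃).map Polynomial.C))).eval r < 0 := mul_neg_of_pos_of_neg hr hdown
  rw [h] at hneg
  linarith


/-- **`1|3` split: a down-crossing root has a positive letter-`0` needle form.**  If `e ≤ d₁, d₂, d₃` (letters `1, 2, 3` above or at the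
pivot), `det J < 0`, weights `≥ 0`, and `r > 0` is a root of `f = det F` with `f′(r) < 0`, then `(e − d₀)·w₀ r^{d₀}·F(r)[v₀^⊥] > 0` — in
particular `d₀ < e`, `w₀ > 0` and `F(r)[v₀^⊥] > 0`: the null vector of `F(r)` is NOT parallel to `v₀`, and the exit from a visit is paid by the
below-pivot letter alone. [this file] -/
theorem below_needle_pos_of_deriv_neg (e d₀ d₁ d₂ d₃ : ℕ) (he₁ : e ≤ d₁) (he₂ : e ≤ d₂) (he₃ : e ≤ d₃)
    (J : Matrix (Fin 2) (Fin 2) ℝ) (hJ : J 1 0 = J 0 1) (hdJ : J 0 0 * J 1 1 - J 0 1 ^ 2 < 0) (v₀ v₁ v₂ v₃ : Fin 2 → ℝ)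
    (w₀ w₁ w₂ w₃ : ℝ) (hw₀ : 0 ≤ w₀) (hw₁ : 0 ≤ w₁) (hw₂ : 0 ≤ w₂) (hw₃ : 0 ≤ w₃) (r : ℝ) (hr : 0 < r)
    (hroot : (Matrix.det (((X : ℝ[X]) ^ e) • J.map Polynomial.C
        + (Polynomial.C w₀ * X ^ d₀) • (vecMulVec v₀ v₀).map Polynomial.C
        + (Polynomial.C w₁ * X ^ d₁) • (vecMulVec v₁ v₁).map Polynomial.C
        + (Polynomial.C w₂ * X ^ d₂) • (vecMulVec v₂ v₂).map Polynomial.C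
        + (Polynomial.C w₃ * X ^ d₃) • (vecMulVec v₃ v₃).map Polynomial.C)).eval r = 0)
    (hdown : (Polynomial.derivative (Matrix.det (((X : ℝ[X]) ^ e) • J.map Polynomial.C
        + (Polynomial.C w₀ * X ^ d₀) • (vecMulVec v₀ v₀).map Polynomial.C
        + (Polynomial.C w₁ * X ^ d₁) • (vecMulVec v₁ v₁).map Polynomial.C
        + (Polynomial.C w₂ * X ^ d₂) • (vecMulVec v₂ v₂).map Polynomial.C
        + (Polynomial.C w₃ * X ^ d₃) • (vecMulVec v₃ v₃).map Polynomial.C))).eval r < 0) :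
    0 < ((e : ℝ) - d₀) * (w₀ * r ^ d₀)
          * (r ^ e * (J 0 0 * (v₀ 1) ^ 2 + 2 * J 0 1 * (v₀ 1 * (-v₀ 0)) + J 1 1 * (-v₀ 0) ^ 2)
            + w₀ * r ^ d₀ * (v₀ 0 * v₀ 1 + v₀ 1 * (-v₀ 0)) ^ 2 + w₁ * r ^ d₁ * (v₁ 0 * v₀ 1 + v₁ 1 * (-v₀ 0)) ^ 2
            + w₂ * r ^ d₂ * (v₂ 0 * v₀ 1 + v₂ 1 * (-v₀ 0)) ^ 2 + w₃ * r ^ d₃ * (v₃ 0 * v₀ 1 + v₃ 1 * (-v₀ 0)) ^ 2) := by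
  have h := below_outweighs_of_deriv_neg e d₀ d₁ d₂ d₃ J hJ v₀ v₁ v₂ v₃ w₀ w₁ w₂ w₃ r hr hroot hdown
  have q₁ := form_nonneg_at_root e d₀ d₁ d₂ d₃ J hJ hdJ v₀ v₁ v₂ v₃ w₀ w₁ w₂ w₃ hw₀ hw₁ hw₂ hw₃ r hr hroot (v₁ 1) (-v₁ 0)
  have q₂ := form_nonneg_at_root e d₀ d₁ d₂ d₃ J hJ hdJ v₀ v₁ v₂ v₃ w₀ w₁ w₂ w₃ hw₀ hw₁ hw₂ hw₃ r hr hroot (v₂ 1) (-v₂ 0)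
  have q₃ := form_nonneg_at_root e d₀ d₁ d₂ d₃ J hJ hdJ v₀ v₁ v₂ v₃ w₀ w₁ w₂ w₃ hw₀ hw₁ hw₂ hw₃ r hr hroot (v₃ 1) (-v₃ 0)
  have c₁ : 0 ≤ ((d₁ : ℝ) - e) * (w₁ * r ^ d₁) := mul_nonneg (sub_nonneg.2 (by exact_mod_cast he₁)) (by positivity)
  have c₂ : 0 ≤ ((d₂ : ℝ) - e) * (w₂ * r ^ d₂) := mul_nonneg (sub_nonneg.2 (by exact_mod_cast he₂)) (by positivity)
  have c₃ : 0 ≤ ((d₃ : ℝ) - e) * (w₃ * r ^ d₃) := mul_nonneg (sub_nonneg.2 (by exact_mod_cast he₃)) (by positivity)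
  have hsum := add_nonneg (add_nonneg (mul_nonneg c₁ q₁) (mul_nonneg c₂ q₂)) (mul_nonneg c₃ q₃)
  exact lt_of_le_of_lt hsum h

end Summit.ValiantsHypothesis.ValiantsHypothesis.Theorems.LacunarySymmetroidMatrixDescartes.Pivot.NullDirection
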